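import Summits.CriticalPhenomena.PercolationContinuityZ3.Theorems.PercNearOneGluingNoHeavyLowerTailIncStarTwoCutFarValid
import Summits.CriticalPhenomena.PercolationContinuityZ3.Theorems.PercNearOneGluingNoHeavyLowerTailIncStarTwoCutFXFormCheck
import Mathlib.Tactic.LinearCombination
import HarnessLib

/-!
# MODE B, XXIII: the far-side inequalities (FX), (FY) from the checked certificates

Support file for the Sahi programme (`--supports stmt-CriticalPhenomena-4575`, prover prim-sahi-p2 gen 28).  No sorries, no named facts;
no `native_decide` in this file, but it USES the computational identities `fx_cert_checkN`, `fy_cert_checkN` (gen 27) and `fxForm_checkN`,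
`fyForm_checkN` (`…IncStarTwoCutFXFormCheck`), so its theorems carry the computational ancestry `Lean.ofReduceBool`.
Chain: `D·FX_form(x) = target(x) = Σ_blocks mult·row(x) ≥ 0` on the valuation `x = val19 (far cell law inside U) q0 qX qY qW`
(rows ≥ 0 by `frowVal_nonneg_of_valid` + `fxBlocks_valid`, monomials ≥ 0), hence `FX_form ≥ 0` (`fxFormVal_nonneg`); with `S_q = S_f = 1`
and the dictionary "mask sums = probabilities of connection events inside `U`" (`real_conn_*`) this is the inequality
**(FX)** `π_xy·σ_u ≤ Φ_X qX + Φ_XY qW + Φ_D qY` (`fx_far_row`) — and symmetrically **(FY)** (`fy_far_row`) — for the connection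
probabilities inside `U` of the four points `x, y, b, c ∈ U` of ANY finite weighted graph, ANY reals `qX, qY, qW ≥ 0` with `qX+qY+qW ≤ 1` and
`(qX+qW)(qY+qW) ≤ qW`, GIVEN the two stars `E₃({x~y},{x~b},{x~c} in U) ≥ 0`, `E₃({y~x},{y~b},{y~c} in U) ≥ 0`.
-/

noncomputable section

namespace Summit.CriticalPhenomena.PercolationContinuityZ3.Theorems

namespace IncStarTwoCut.FXCert

open MeasureTheory Lean.Grind.CommRing FourPointCert IncStarTwoCut.FarCert Literature.Probability.Percolation Literature.Probability.LatticeModels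
open scoped Classical

variable {V : Type} [Fintype V] (U : Finset V) (x y b c : V) (w : Sym2 V → unitInterval)

/-! ### Dictionary: mask sums of the far masks are connection probabilities inside `U` -/

section Dict

omit [Fintype V] in
/-- The mask event of `mBX` is the connection event `{x ~ b}` inside `U`. [this work] -/
theorem fpre_BX : fpre (↑U : Set V) x y b c mBX = openConnIn (↑U : Set V) x b :=
  fpre_fconnMask _ _ _ _ _ (by norm_num) (by norm_num) (by norm_num)
omit [Fintype V] in
/-- The mask event of `mBY` is the connection event `{y ~ b}` inside `U`. [this work] -/
theorem fpre_BY : fpre (↑U : Set V) x y b c mBY = openConnIn (↑U : Set V) y b :=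
  fpre_fconnMask _ _ _ _ _ (by norm_num) (by norm_num) (by norm_num)
omit [Fintype V] in
/-- The mask event of `mCX` is the connection event `{x ~ c}` inside `U`. [this work] -/
theorem fpre_CX : fpre (↑U : Set V) x y b c mCX = openConnIn (↑U : Set V) x c :=
  fpre_fconnMask _ _ _ _ _ (by norm_num) (by norm_num) (by norm_num)
omit [Fintype V] in
/-- The mask event of `mCY` is the connection event `{y ~ c}` inside `U`. [this work] -/
theorem fpre_CY : fpre (↑U : Set V) x y b c mCY = openConnIn (↑U : Set V) y c :=
  fpre_fconnMask _ _ _ _ _ (by norm_num) (by norm_num) (by norm_num)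

omit [Fintype V] in
/-- A set difference as an intersection with a `full`-complement mask. [this work] -/
theorem fpre_and_xor (A B : ℕ) : fpre (↑U : Set V) x y b c (A &&& (full ^^^ B)) = fpre (↑U : Set V) x y b c A \ fpre (↑U : Set V) x y b c B := by
  rw [fpre_and, fpre_xor_full]
  ext ω
  exact Iff.rfl

/-- `m(x~b) = P(x~b in U)`. [this work] -/
theorem real_conn_bx : (prodBernoulli w).real (openConnIn (↑U : Set V) x b) = msum mBX (fcellLaw (↑U : Set V) x y b c w) := by rw [← real_fpre, fpre_BX]
/-- `m(y~b) = P(y~b in U)`. [this work] -/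
theorem real_conn_by : (prodBernoulli w).real (openConnIn (↑U : Set V) y b) = msum mBY (fcellLaw (↑U : Set V) x y b c w) := by rw [← real_fpre, fpre_BY]
/-- `P({x~b} ∪ {y~b})`. [this work] -/
theorem real_conn_bU : (prodBernoulli w).real (openConnIn (↑U : Set V) x b ∪ openConnIn (↑U : Set V) y b) = msum mBU (fcellLaw (↑U : Set V) x y b c w) := by
  rw [← real_fpre, mBU, fpre_or, fpre_BX, fpre_BY]
/-- `P({x~b} ∩ {y~b})`. [this work] -/
theorem real_conn_bN : (prodBernoulli w).real (openConnIn (↑U : Set V) x b ∩ openConnIn (↑U : Set V) y b) = msum mBN (fcellLaw (↑U : Set V) x y b c w) := by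
  rw [← real_fpre, mBN, fpre_and, fpre_BX, fpre_BY]
/-- `P({x~b} ∖ {y~b})`. [this work] -/
theorem real_conn_bpx : (prodBernoulli w).real (openConnIn (↑U : Set V) x b \ openConnIn (↑U : Set V) y b) = msum mBpx (fcellLaw (↑U : Set V) x y b c w) := by
  rw [← real_fpre, mBpx, fpre_and_xor, fpre_BX, fpre_BY]
/-- `P({y~b} ∖ {x~b})`. [this work] -/
theorem real_conn_bpy : (prodBernoulli w).real (openConnIn (↑U : Set V) y b \ openConnIn (↑U : Set V) x b) = msum mBpy (fcellLaw (↑U : Set V) x y b c w) := by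
  rw [← real_fpre, mBpy, fpre_and_xor, fpre_BX, fpre_BY]
/-- `m(x~c) = P(x~c in U)`. [this work] -/
theorem real_conn_cx : (prodBernoulli w).real (openConnIn (↑U : Set V) x c) = msum mCX (fcellLaw (↑U : Set V) x y b c w) := by rw [← real_fpre, fpre_CX]
/-- `m(y~c) = P(y~c in U)`. [this work] -/
theorem real_conn_cy : (prodBernoulli w).real (openConnIn (↑U : Set V) y c) = msum mCY (fcellLaw (↑U : Set V) x y b c w) := by rw [← real_fpre, fpre_CY]
/-- `P({x~c} ∪ {y~c})`. [this work] -/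
theorem real_conn_cU : (prodBernoulli w).real (openConnIn (↑U : Set V) x c ∪ openConnIn (↑U : Set V) y c) = msum mCU (fcellLaw (↑U : Set V) x y b c w) := by
  rw [← real_fpre, mCU, fpre_or, fpre_CX, fpre_CY]
/-- `P({x~c} ∩ {y~c})`. [this work] -/
theorem real_conn_cN : (prodBernoulli w).real (openConnIn (↑U : Set V) x c ∩ openConnIn (↑U : Set V) y c) = msum mCN (fcellLaw (↑U : Set V) x y b c w) := by
  rw [← real_fpre, mCN, fpre_and, fpre_CX, fpre_CY]
/-- `P({x~c} ∖ {y~c})`. [this work] -/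
theorem real_conn_cpx : (prodBernoulli w).real (openConnIn (↑U : Set V) x c \ openConnIn (↑U : Set V) y c) = msum mCpx (fcellLaw (↑U : Set V) x y b c w) := by
  rw [← real_fpre, mCpx, fpre_and_xor, fpre_CX, fpre_CY]
/-- `P({y~c} ∖ {x~c})`. [this work] -/
theorem real_conn_cpy : (prodBernoulli w).real (openConnIn (↑U : Set V) y c \ openConnIn (↑U : Set V) x c) = msum mCpy (fcellLaw (↑U : Set V) x y b c w) := by
  rw [← real_fpre, mCpy, fpre_and_xor, fpre_CX, fpre_CY]
/-- `P({x~b} ∩ {x~c})`. [this work] -/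
theorem real_conn_mxx : (prodBernoulli w).real (openConnIn (↑U : Set V) x b ∩ openConnIn (↑U : Set V) x c) = msum mMxx (fcellLaw (↑U : Set V) x y b c w) := by
  rw [← real_fpre, mMxx, fpre_and, fpre_BX, fpre_CX]
/-- `P({y~b} ∩ {y~c})`. [this work] -/
theorem real_conn_myy : (prodBernoulli w).real (openConnIn (↑U : Set V) y b ∩ openConnIn (↑U : Set V) y c) = msum mMyy (fcellLaw (↑U : Set V) x y b c w) := by
  rw [← real_fpre, mMyy, fpre_and, fpre_BY, fpre_CY]
/-- `P(({x~b} ∪ {y~b}) ∩ ({x~c} ∪ {y~c}))`. [this work] -/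
theorem real_conn_mU : (prodBernoulli w).real ((openConnIn (↑U : Set V) x b ∪ openConnIn (↑U : Set V) y b) ∩
    (openConnIn (↑U : Set V) x c ∪ openConnIn (↑U : Set V) y c)) = msum mMU (fcellLaw (↑U : Set V) x y b c w) := by
  rw [← real_fpre, mMU, fpre_and, fpre_or, fpre_or, fpre_BX, fpre_BY, fpre_CX, fpre_CY]
/-- `P(({x~b} ∩ {y~b}) ∩ ({x~c} ∩ {y~c}))`. [this work] -/
theorem real_conn_mN : (prodBernoulli w).real ((openConnIn (↑U : Set V) x b ∩ openConnIn (↑U : Set V) y b) ∩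
    (openConnIn (↑U : Set V) x c ∩ openConnIn (↑U : Set V) y c)) = msum mMN (fcellLaw (↑U : Set V) x y b c w) := by
  rw [← real_fpre, mMN, fpre_and, fpre_and, fpre_and, fpre_BX, fpre_BY, fpre_CX, fpre_CY]
/-- `m(x~y) = P(x~y in U)`. [this work] -/
theorem real_conn_z : (prodBernoulli w).real (openConnIn (↑U : Set V) x y) = msum mZ (fcellLaw (↑U : Set V) x y b c w) := by
  rw [← real_fpre, mZ, fpre_fconnMask _ _ _ _ _ (by norm_num) (by norm_num) (by norm_num)]; rfl

end Dict

variable [DecidableEq V]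

/-! ### The forms are nonnegative on a law -/

/-- **`FX_form ≥ 0`** on the valuation of a far cell law and nonnegative `q`'s with `c_q ≥ 0`, given the two far stars. [this work] -/
theorem fxFormVal_nonneg (hlab : ∀ i < 4, lab x y b c i ∈ U) {q0 qX qY qW : ℝ} (h0 : 0 ≤ q0) (hX : 0 ≤ qX) (hY : 0 ≤ qY) (hW : 0 ≤ qW)
    (hcq : 0 ≤ qW * (q0 + qX + qY + qW) - (qX + qW) * (qY + qW))
    (hS0 : 0 ≤ sahiE3 (prodBernoulli w) (openConnIn (↑U : Set V) x y) (openConnIn (↑U : Set V) x b) (openConnIn (↑U : Set V) x c))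
    (hS1 : 0 ≤ sahiE3 (prodBernoulli w) (openConnIn (↑U : Set V) y x) (openConnIn (↑U : Set V) y b) (openConnIn (↑U : Set V) y c)) :
    0 ≤ fxFormVal (val19 (fcellLaw (↑U : Set V) x y b c w) q0 qX qY qW) := by
  set xv := val19 (fcellLaw (↑U : Set V) x y b c w) q0 qX qY qW with hxv
  have h1 := Expr.eq_of_toPoly_eq (ctx19 xv) _ _ fxForm_checkN
  rw [denote_mul, denote_natCast, denote_fxFormE,
    denote_ftargetE xv _ _ (monosWf_spec fxTarget_wf.1) (monosWf_spec fxTarget_wf.2),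
    ftarget_eq_fcert xv fx_cert_checkN fxTarget_wf.1 fxTarget_wf.2 fxBlocks_wf'] at h1
  have h2 : 0 ≤ fcertVal fxBlocks xv :=
    fcertVal_nonneg xv fxBlocks (val19_nonneg (fcellLaw_nonneg (↑U : Set V) x y b c w) h0 hX hY hW)
      (fun blk hb => frowVal_nonneg_of_valid (w := w) hlab hcq hS0 hS1 blk.row (fxBlocks_valid' blk hb))
  rw [← h1] at h2
  have h3 : (0 : ℝ) ≤ 166668 * fxFormVal xv := by exact_mod_cast h2
  linarith

/-- **`FY_form ≥ 0`**, symmetrically. [this work] -/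
theorem fyFormVal_nonneg (hlab : ∀ i < 4, lab x y b c i ∈ U) {q0 qX qY qW : ℝ} (h0 : 0 ≤ q0) (hX : 0 ≤ qX) (hY : 0 ≤ qY) (hW : 0 ≤ qW)
    (hcq : 0 ≤ qW * (q0 + qX + qY + qW) - (qX + qW) * (qY + qW))
    (hS0 : 0 ≤ sahiE3 (prodBernoulli w) (openConnIn (↑U : Set V) x y) (openConnIn (↑U : Set V) x b) (openConnIn (↑U : Set V) x c))
    (hS1 : 0 ≤ sahiE3 (prodBernoulli w) (openConnIn (↑U : Set V) y x) (openConnIn (↑U : Set V) y b) (openConnIn (↑U : Set V) y c)) :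
    0 ≤ fyFormVal (val19 (fcellLaw (↑U : Set V) x y b c w) q0 qX qY qW) := by
  set xv := val19 (fcellLaw (↑U : Set V) x y b c w) q0 qX qY qW with hxv
  have h1 := Expr.eq_of_toPoly_eq (ctx19 xv) _ _ fyForm_checkN
  rw [denote_mul, denote_natCast, denote_fyFormE,
    denote_ftargetE xv _ _ (monosWf_spec fyTarget_wf.1) (monosWf_spec fyTarget_wf.2),
    ftarget_eq_fcert xv fy_cert_checkN fyTarget_wf.1 fyTarget_wf.2 fyBlocks_wf'] at h1
  have h2 : 0 ≤ fcertVal fyBlocks xv :=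
    fcertVal_nonneg xv fyBlocks (val19_nonneg (fcellLaw_nonneg (↑U : Set V) x y b c w) h0 hX hY hW)
      (fun blk hb => frowVal_nonneg_of_valid (w := w) hlab hcq hS0 hS1 blk.row (fyBlocks_valid' blk hb))
  rw [← h1] at h2
  have h3 : (0 : ℝ) ≤ 144432 * fyFormVal xv := by exact_mod_cast h2
  linarith

/-! ### De-homogenisation: the forms on a law -/

/-- The (FX) form on `val19 f (1 − qX − qY − qW) qX qY qW` with `Σ cells = 1`, in the outside/near vocabulary of (R1). [this work] -/
theorem fxFormVal_eq (f : ℕ → ℝ) (qX qY qW : ℝ) (hSF : msum full f = 1) :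
    fxFormVal (val19 f (1 - (qX + qY + qW)) qX qY qW) =
      (2 * msum mMxx f - msum mBX f * (qX * msum mCX f + qY * msum mCY f + qW * msum mCU f)
          - msum mCX f * (qX * msum mBX f + qY * msum mBY f + qW * msum mBU f)
          - ((qX * msum mMxx f + qY * msum mMyy f + qW * msum mMU f)
              - (qX * msum mBX f + qY * msum mBY f + qW * msum mBU f) * (qX * msum mCX f + qY * msum mCY f + qW * msum mCU f))) * qX
      + (2 * msum mMU f - msum mBU f * (qX * msum mCX f + qY * msum mCY f + qW * msum mCU f)
          - msum mCU f * (qX * msum mBX f + qY * msum mBY f + qW * msum mBU f)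
          - ((qX * msum mMxx f + qY * msum mMyy f + qW * msum mMU f)
              - (qX * msum mBX f + qY * msum mBY f + qW * msum mBU f) * (qX * msum mCX f + qY * msum mCY f + qW * msum mCU f))) * qW
      + (2 * msum mMN f - msum mBN f * (qX * msum mCX f + qY * msum mCY f + qW * msum mCU f)
          - msum mCN f * (qX * msum mBX f + qY * msum mBY f + qW * msum mBU f)
          - msum mZ f * ((qX * msum mMxx f + qY * msum mMyy f + qW * msum mMU f)
              - (qX * msum mBX f + qY * msum mBY f + qW * msum mBU f) * (qX * msum mCX f + qY * msum mCY f + qW * msum mCU f))) * qY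
      - (msum mBpx f * msum mCpy f + msum mBpy f * msum mCpx f) * ((1 - (qX + qW)) * (2 * qW - (qX + qW) * (qY + qW))) := by
  have hq := val19_q f (1 - (qX + qY + qW)) qX qY qW
  simp only [fxFormVal, sqVal, pbVal, pcVal, pbcVal, k22Val, phiXVal, phiXYVal, phiDVal, twoWVal, pixyVal, msum_val19, hq.1, hq.2.1,
    hq.2.2.1, hq.2.2.2, hSF]
  ring

/-- The (FY) form on a law, in the vocabulary of (R1). [this work] -/
theorem fyFormVal_eq (f : ℕ → ℝ) (qX qY qW : ℝ) (hSF : msum full f = 1) :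
    fyFormVal (val19 f (1 - (qX + qY + qW)) qX qY qW) =
      (2 * msum mMyy f - msum mBY f * (qX * msum mCX f + qY * msum mCY f + qW * msum mCU f)
          - msum mCY f * (qX * msum mBX f + qY * msum mBY f + qW * msum mBU f)
          - ((qX * msum mMxx f + qY * msum mMyy f + qW * msum mMU f)
              - (qX * msum mBX f + qY * msum mBY f + qW * msum mBU f) * (qX * msum mCX f + qY * msum mCY f + qW * msum mCU f))) * qY
      + (2 * msum mMU f - msum mBU f * (qX * msum mCX f + qY * msum mCY f + qW * msum mCU f)
          - msum mCU f * (qX * msum mBX f + qY * msum mBY f + qW * msum mBU f)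
          - ((qX * msum mMxx f + qY * msum mMyy f + qW * msum mMU f)
              - (qX * msum mBX f + qY * msum mBY f + qW * msum mBU f) * (qX * msum mCX f + qY * msum mCY f + qW * msum mCU f))) * qW
      + (2 * msum mMN f - msum mBN f * (qX * msum mCX f + qY * msum mCY f + qW * msum mCU f)
          - msum mCN f * (qX * msum mBX f + qY * msum mBY f + qW * msum mBU f)
          - msum mZ f * ((qX * msum mMxx f + qY * msum mMyy f + qW * msum mMU f)
              - (qX * msum mBX f + qY * msum mBY f + qW * msum mBU f) * (qX * msum mCX f + qY * msum mCY f + qW * msum mCU f))) * qX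
      - (msum mBpx f * msum mCpy f + msum mBpy f * msum mCpx f) * ((1 - (qY + qW)) * (2 * qW - (qX + qW) * (qY + qW))) := by
  have hq := val19_q f (1 - (qX + qY + qW)) qX qY qW
  simp only [fyFormVal, sqVal, pbVal, pcVal, pbcVal, k22Val, phiYVal, phiXYVal, phiDVal, twoWVal, pixyVal, msum_val19, hq.1, hq.2.1,
    hq.2.2.1, hq.2.2.2, hSF]
  ring

/-! ### (FX) and (FY) in probabilities -/

/-- **(FX).**  For any finite weighted graph, a vertex set `U` containing the four points `x, y, b, c`, and reals `qX, qY, qW ≥ 0` with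
`qX + qY + qW ≤ 1`, `(qX+qW)(qY+qW) ≤ qW`: if the two stars `E₃({x~y},{x~b},{x~c} in U)`, `E₃({y~x},{y~b},{y~c} in U)` are `≥ 0`, then
`π_xy·(1 − x̄)(2w − x̄ȳ) ≤ Φ_X qX + Φ_XY qW + Φ_D qY` in the outside numbers of the connections inside `U`. [this work] -/
theorem fx_far_row (hlab : ∀ i < 4, lab x y b c i ∈ U) {qX qY qW : ℝ} (hX : 0 ≤ qX) (hY : 0 ≤ qY) (hW : 0 ≤ qW) (h1 : qX + qY + qW ≤ 1)
    (hcq : (qX + qW) * (qY + qW) ≤ qW)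
    (hS0 : 0 ≤ sahiE3 (prodBernoulli w) (openConnIn (↑U : Set V) x y) (openConnIn (↑U : Set V) x b) (openConnIn (↑U : Set V) x c))
    (hS1 : 0 ≤ sahiE3 (prodBernoulli w) (openConnIn (↑U : Set V) y x) (openConnIn (↑U : Set V) y b) (openConnIn (↑U : Set V) y c))
    {Pb Qb Pc Qc : Set (BondConfig V)} (hPb : Pb = openConnIn (↑U : Set V) x b) (hQb : Qb = openConnIn (↑U : Set V) y b)
    (hPc : Pc = openConnIn (↑U : Set V) x c) (hQc : Qc = openConnIn (↑U : Set V) y c)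
    {bx by_ bU bN bpx bpy cx cy cU cN cpx cpy mxx myy mU mN ζ : ℝ}
    (hbx : bx = (prodBernoulli w).real Pb) (hby : by_ = (prodBernoulli w).real Qb)
    (hbU : bU = (prodBernoulli w).real (Pb ∪ Qb)) (hbN : bN = (prodBernoulli w).real (Pb ∩ Qb))
    (hbpx : bpx = (prodBernoulli w).real (Pb \ Qb)) (hbpy : bpy = (prodBernoulli w).real (Qb \ Pb))
    (hcx : cx = (prodBernoulli w).real Pc) (hcy : cy = (prodBernoulli w).real Qc)
    (hcU : cU = (prodBernoulli w).real (Pc ∪ Qc)) (hcN : cN = (prodBernoulli w).real (Pc ∩ Qc))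
    (hcpx : cpx = (prodBernoulli w).real (Pc \ Qc)) (hcpy : cpy = (prodBernoulli w).real (Qc \ Pc))
    (hmxx : mxx = (prodBernoulli w).real (Pb ∩ Pc)) (hmyy : myy = (prodBernoulli w).real (Qb ∩ Qc))
    (hmU : mU = (prodBernoulli w).real ((Pb ∪ Qb) ∩ (Pc ∪ Qc))) (hmN : mN = (prodBernoulli w).real ((Pb ∩ Qb) ∩ (Pc ∩ Qc)))
    (hζ : ζ = (prodBernoulli w).real (openConnIn (↑U : Set V) x y)) :
    (bpx * cpy + bpy * cpx) * ((1 - (qX + qW)) * (2 * qW - (qX + qW) * (qY + qW))) ≤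
      (2 * mxx - bx * (qX * cx + qY * cy + qW * cU) - cx * (qX * bx + qY * by_ + qW * bU)
          - ((qX * mxx + qY * myy + qW * mU) - (qX * bx + qY * by_ + qW * bU) * (qX * cx + qY * cy + qW * cU))) * qX
      + (2 * mU - bU * (qX * cx + qY * cy + qW * cU) - cU * (qX * bx + qY * by_ + qW * bU)
          - ((qX * mxx + qY * myy + qW * mU) - (qX * bx + qY * by_ + qW * bU) * (qX * cx + qY * cy + qW * cU))) * qW
      + (2 * mN - bN * (qX * cx + qY * cy + qW * cU) - cN * (qX * bx + qY * by_ + qW * bU)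
          - ζ * ((qX * mxx + qY * myy + qW * mU) - (qX * bx + qY * by_ + qW * bU) * (qX * cx + qY * cy + qW * cU))) * qY := by
  subst hPb hQb hPc hQc
  have hF := fxFormVal_nonneg U x y b c w hlab (q0 := 1 - (qX + qY + qW)) (by linarith) hX hY hW (by nlinarith) hS0 hS1
  rw [fxFormVal_eq _ qX qY qW (msum_full_fcellLaw _ _ _ _ _ _)] at hF
  rw [real_conn_bx U x y b c w] at hbx; rw [real_conn_by U x y b c w] at hby; rw [real_conn_bU U x y b c w] at hbU
  rw [real_conn_bN U x y b c w] at hbN; rw [real_conn_bpx U x y b c w] at hbpx; rw [real_conn_bpy U x y b c w] at hbpy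
  rw [real_conn_cx U x y b c w] at hcx; rw [real_conn_cy U x y b c w] at hcy; rw [real_conn_cU U x y b c w] at hcU
  rw [real_conn_cN U x y b c w] at hcN; rw [real_conn_cpx U x y b c w] at hcpx; rw [real_conn_cpy U x y b c w] at hcpy
  rw [real_conn_mxx U x y b c w] at hmxx; rw [real_conn_myy U x y b c w] at hmyy; rw [real_conn_mU U x y b c w] at hmU
  rw [real_conn_mN U x y b c w] at hmN; rw [real_conn_z U x y b c w] at hζ
  subst hbx hby hbU hbN hbpx hbpy hcx hcy hcU hcN hcpx hcpy hmxx hmyy hmU hmN hζ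
  linear_combination hF

/-- **(FY).**  Symmetric statement at the port `y`: `π_xy·(1 − ȳ)(2w − x̄ȳ) ≤ Φ_Y qY + Φ_XY qW + Φ_D qX`. [this work] -/
theorem fy_far_row (hlab : ∀ i < 4, lab x y b c i ∈ U) {qX qY qW : ℝ} (hX : 0 ≤ qX) (hY : 0 ≤ qY) (hW : 0 ≤ qW) (h1 : qX + qY + qW ≤ 1)
    (hcq : (qX + qW) * (qY + qW) ≤ qW)
    (hS0 : 0 ≤ sahiE3 (prodBernoulli w) (openConnIn (↑U : Set V) x y) (openConnIn (↑U : Set V) x b) (openConnIn (↑U : Set V) x c))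
    (hS1 : 0 ≤ sahiE3 (prodBernoulli w) (openConnIn (↑U : Set V) y x) (openConnIn (↑U : Set V) y b) (openConnIn (↑U : Set V) y c))
    {Pb Qb Pc Qc : Set (BondConfig V)} (hPb : Pb = openConnIn (↑U : Set V) x b) (hQb : Qb = openConnIn (↑U : Set V) y b)
    (hPc : Pc = openConnIn (↑U : Set V) x c) (hQc : Qc = openConnIn (↑U : Set V) y c)
    {bx by_ bU bN bpx bpy cx cy cU cN cpx cpy mxx myy mU mN ζ : ℝ}
    (hbx : bx = (prodBernoulli w).real Pb) (hby : by_ = (prodBernoulli w).real Qb)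
    (hbU : bU = (prodBernoulli w).real (Pb ∪ Qb)) (hbN : bN = (prodBernoulli w).real (Pb ∩ Qb))
    (hbpx : bpx = (prodBernoulli w).real (Pb \ Qb)) (hbpy : bpy = (prodBernoulli w).real (Qb \ Pb))
    (hcx : cx = (prodBernoulli w).real Pc) (hcy : cy = (prodBernoulli w).real Qc)
    (hcU : cU = (prodBernoulli w).real (Pc ∪ Qc)) (hcN : cN = (prodBernoulli w).real (Pc ∩ Qc))
    (hcpx : cpx = (prodBernoulli w).real (Pc \ Qc)) (hcpy : cpy = (prodBernoulli w).real (Qc \ Pc))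
    (hmxx : mxx = (prodBernoulli w).real (Pb ∩ Pc)) (hmyy : myy = (prodBernoulli w).real (Qb ∩ Qc))
    (hmU : mU = (prodBernoulli w).real ((Pb ∪ Qb) ∩ (Pc ∪ Qc))) (hmN : mN = (prodBernoulli w).real ((Pb ∩ Qb) ∩ (Pc ∩ Qc)))
    (hζ : ζ = (prodBernoulli w).real (openConnIn (↑U : Set V) x y)) :
    (bpx * cpy + bpy * cpx) * ((1 - (qY + qW)) * (2 * qW - (qX + qW) * (qY + qW))) ≤
      (2 * myy - by_ * (qX * cx + qY * cy + qW * cU) - cy * (qX * bx + qY * by_ + qW * bU)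
          - ((qX * mxx + qY * myy + qW * mU) - (qX * bx + qY * by_ + qW * bU) * (qX * cx + qY * cy + qW * cU))) * qY
      + (2 * mU - bU * (qX * cx + qY * cy + qW * cU) - cU * (qX * bx + qY * by_ + qW * bU)
          - ((qX * mxx + qY * myy + qW * mU) - (qX * bx + qY * by_ + qW * bU) * (qX * cx + qY * cy + qW * cU))) * qW
      + (2 * mN - bN * (qX * cx + qY * cy + qW * cU) - cN * (qX * bx + qY * by_ + qW * bU)
          - ζ * ((qX * mxx + qY * myy + qW * mU) - (qX * bx + qY * by_ + qW * bU) * (qX * cx + qY * cy + qW * cU))) * qX := by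
  subst hPb hQb hPc hQc
  have hF := fyFormVal_nonneg U x y b c w hlab (q0 := 1 - (qX + qY + qW)) (by linarith) hX hY hW (by nlinarith) hS0 hS1
  rw [fyFormVal_eq _ qX qY qW (msum_full_fcellLaw _ _ _ _ _ _)] at hF
  rw [real_conn_bx U x y b c w] at hbx; rw [real_conn_by U x y b c w] at hby; rw [real_conn_bU U x y b c w] at hbU
  rw [real_conn_bN U x y b c w] at hbN; rw [real_conn_bpx U x y b c w] at hbpx; rw [real_conn_bpy U x y b c w] at hbpy
  rw [real_conn_cx U x y b c w] at hcx; rw [real_conn_cy U x y b c w] at hcy; rw [real_conn_cU U x y b c w] at hcU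
  rw [real_conn_cN U x y b c w] at hcN; rw [real_conn_cpx U x y b c w] at hcpx; rw [real_conn_cpy U x y b c w] at hcpy
  rw [real_conn_mxx U x y b c w] at hmxx; rw [real_conn_myy U x y b c w] at hmyy; rw [real_conn_mU U x y b c w] at hmU
  rw [real_conn_mN U x y b c w] at hmN; rw [real_conn_z U x y b c w] at hζ
  subst hbx hby hbU hbN hbpx hbpy hcx hcy hcU hcN hcpx hcpy hmxx hmyy hmU hmN hζ
  linear_combination hF

end IncStarTwoCut.FXCert

end Summit.CriticalPhenomena.PercolationContinuityZ3.Theorems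

end
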